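import Summits.CriticalPhenomena.SAWScalingLimit.Theorems.SAWTotalPositivityBoundaryTP2Defs
import Summits.CriticalPhenomena.SAWScalingLimit.Theorems.SAWTotalPositivityBoundaryTP2Kernel
import Summits.CriticalPhenomena.SAWScalingLimit.Theorems.SAWTotalPositivityBoundaryTP2LadderKernelsInterior
import Summits.CriticalPhenomena.SAWScalingLimit.Theorems.EdgeOfPositivity.Negative.EdgeOfPositivityRectDomain
import HarnessLib

/-!
# Crux `BoundaryTP2` (stmt-CriticalPhenomena-7115), line `Sketch`: the generic column-separated minor on a ladder

Tool stub `stub_ladder_minorCB` of the line's skeleton: on the ladder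
`R_L = discreteDomainGraph (rectDomain L 1) 1` (sites `{0..L} × {0,1}`) let `u₁ = (i₁,r₁)`, `u₂ = (i₂,r₂)`
lie strictly left of `v₁ = (j₁,s₁)`, `v₂ = (j₂,s₂)` (`max i₁ i₂ < min j₁ j₂ ≤ L`), with `u₁` before `u₂` in
the boundary order seen from the left end and `v₁` before `v₂` in the order seen from the right end.
Then for every fugacity `0 ≤ x ≤ 1/2` the crossing pairing weighs at most the nested one:

  `Z(u₁,v₁) Z(u₂,v₂) ≤ Z(u₁,v₂) Z(u₂,v₁)`,   `Z = pathKernel R_L x`.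

Proof. Write `P = 1+x`, `M = 1-x`, `E_k = Σ_{d<k} x^{2d+3}`, `a_i = P + E_i`, `a'_i = M - E_i`,
`b_j = P + E_{L-j}`, `b'_j = M - E_{L-j}` and `ρ(r) = 1 - 2r ∈ {±1}`. Fix a pivot column `c` with
`i₁, i₂ ≤ c < j₁, j₂`. By the landed two-point kernels (`stub_ladderKernels_interior`) the kernel has the
RANK-TWO form (`ladderCB_kernel`, a `ring` identity)

  `Z((i,r),(j,s)) = x/2 · x^{c-i} x^{j-c-1} · (A B + A' B')`,
  `A = a_i P^{c-i}`, `A' = ρ(r) a'_i M^{c-i}`, `B = b_j P^{j-c-1}`, `B' = ρ(s) b'_j M^{j-c-1}`,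

i.e. `Z = x^{j-i}/2 · ⟨ℓ(i,r), r(j,s)⟩` with `ℓ = (A, A')` depending on the left site only and `r = (B, B')`
on the right site only. Cauchy–Binet with inner dimension two (`ladderCB_real`, `ring`):

  `Z(u₁,v₂)Z(u₂,v₁) - Z(u₁,v₁)Z(u₂,v₂) = (x/2)² x^{Σ} · (A₁A'₂ - A'₁A₂) · (-(B₁B'₂ - B'₁B₂))`.

The left cross product `A₁A'₂ - A'₁A₂` is `≥ 0` under the left order (`ladderCB_signL`) and the right
one `B₁B'₂ - B'₁B₂` is `≤ 0` under the right order (`ladderCB_signR`): for sites on different rows this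
is a sum of two nonnegative products (`a' , b' ≥ 0` because `E_k (1-x²) = x³ - x^{2k+3} ≤ x³` and
`3x² ≤ 1`), and for sites on the same row it is, up to the factor `(PM)^{min}`, the orientation
determinant `(P+E₁)(M-E₂)P^{d} - (M-E₁)(P+E₂)M^{d} ≥ 0` (`d ≥ 1`, `E₁` at the outer site) of the landed
bottom-row case (`ladderCB_orient`: reduce to `d = 1` by `M ≤ P`, then
`(1-x²)·diff = 2(x(1-3x²) + E₁(1-2x²) + (x³-E₂(1-x²))(1+x²) + xE₁(x³-E₂(1-x²))) ≥ 0`).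
The assembly in `ℝ≥0∞` is `ENNReal.ofReal_mul` / `ENNReal.ofReal_le_ofReal` (`ladderCB_form_nonneg`).
-/

noncomputable section

namespace Summit.CriticalPhenomena.SAWScalingLimit.Theorems.BoundaryTP2

open Literature.Probability.LatticeModels Literature.Probability.RandomPlanarGeometry
open Summit.CriticalPhenomena.SAWScalingLimit.Theorems.EdgeOfPositivity.Negative
open scoped ENNReal

/-! ## The excursion sums `E_k = Σ_{d<k} x^{2d+3}` -/

/-- Geometric identity `E_k (1 - x²) = x³ - x^{2k+3}`. [folklore] -/
private theorem ladderCB_excursion_mul (x : ℝ) (k : ℕ) :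
    (∑ d ∈ Finset.range k, x ^ (2 * d + 3)) * (1 - x ^ 2) = x ^ 3 - x ^ (2 * k + 3) := by
  -- adapted from `ladderNest_excursion_mul` (LadderBottomRowNested)
  induction k with
  | zero => simp
  | succ k ih =>
    rw [Finset.sum_range_succ, add_mul, ih]
    ring

/-- Geometric bound `E_k (1 - x²) ≤ x³` for `x ≥ 0`. [folklore] -/
private theorem ladderCB_excursion_bound {x : ℝ} (hx : 0 ≤ x) (k : ℕ) :
    (∑ d ∈ Finset.range k, x ^ (2 * d + 3)) * (1 - x ^ 2) ≤ x ^ 3 := by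
  rw [ladderCB_excursion_mul]
  linarith [pow_nonneg hx (2 * k + 3)]

/-- `E_k ≥ 0` for `x ≥ 0`. [folklore] -/
private theorem ladderCB_excursion_nonneg {x : ℝ} (hx : 0 ≤ x) (k : ℕ) :
    0 ≤ ∑ d ∈ Finset.range k, x ^ (2 * d + 3) :=
  Finset.sum_nonneg fun _ _ => pow_nonneg hx _

/-- For `0 ≤ x ≤ 1/2` and `0 ≤ E` with `E (1-x²) ≤ x³` one has `E ≤ 1/6`, so `1 - x - E ≥ 0`. [folklore] -/
private theorem ladderCB_coef_nonneg {x E : ℝ} (hx0 : 0 ≤ x) (hx : x ≤ 1 / 2) (hE : 0 ≤ E)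
    (hEb : E * (1 - x ^ 2) ≤ x ^ 3) : 0 ≤ 1 - x - E := by
  have hx2 : x ^ 2 ≤ (1 / 2) ^ 2 := pow_le_pow_left₀ hx0 hx 2
  have hx3 : x ^ 3 ≤ (1 / 2) ^ 3 := pow_le_pow_left₀ hx0 hx 3
  norm_num at hx2 hx3
  have h1 : E * (3 / 4) ≤ E * (1 - x ^ 2) := mul_le_mul_of_nonneg_left (by linarith) hE
  linarith

/-! ## The orientation determinant of two sites on one row -/

/-- **Sign of the orientation determinant.** For `0 ≤ x ≤ 1/2`, `E₁, E₂ ≥ 0` with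
`E₁ (1-x²) ≤ x³`, `E₂ (1-x²) ≤ x³`, and every `u`,
`(1-x-E₁)(1+x+E₂)(1-x)^{u+1} ≤ (1+x+E₁)(1-x-E₂)(1+x)^{u+1}`: by `(1-x)^u ≤ (1+x)^u` it suffices to
treat `u = 0`, where `(1-x²)·(RHS - LHS) = 2(x(1-3x²) + E₁(1-2x²) + (x³-E₂(1-x²))(1+x²) + xE₁(x³-E₂(1-x²)))`
is a sum of nonnegative terms. [folklore] -/
private theorem ladderCB_orient {x E₁ E₂ : ℝ} (hx0 : 0 ≤ x) (hx : x ≤ 1 / 2) (hE₁ : 0 ≤ E₁)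
    (hE₂ : 0 ≤ E₂) (hE₁b : E₁ * (1 - x ^ 2) ≤ x ^ 3) (hE₂b : E₂ * (1 - x ^ 2) ≤ x ^ 3) (u : ℕ) :
    0 ≤ (1 + x + E₁) * (1 - x - E₂) * (1 + x) ^ (u + 1) -
      (1 - x - E₁) * (1 + x + E₂) * (1 - x) ^ (u + 1) := by
  -- adapted from `ladderNest_orient` (LadderBottomRowNested)
  have hx2 : x ^ 2 ≤ (1 / 2) ^ 2 := pow_le_pow_left₀ hx0 hx 2
  norm_num at hx2
  have ha₁ : 0 ≤ 1 - x - E₁ := ladderCB_coef_nonneg hx0 hx hE₁ hE₁b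
  -- the case `u = 0`
  have hD : 0 ≤ (1 + x + E₁) * (1 - x - E₂) * (1 + x) - (1 - x - E₁) * (1 + x + E₂) * (1 - x) := by
    have h1x2 : 0 < 1 - x ^ 2 := by linarith
    have hE₂' : 0 ≤ x ^ 3 - E₂ * (1 - x ^ 2) := by linarith
    have t1 : 0 ≤ x * (1 - 3 * x ^ 2) := mul_nonneg hx0 (by linarith)
    have t2 : 0 ≤ E₁ * (1 - 2 * x ^ 2) := mul_nonneg hE₁ (by linarith)
    have t3 : 0 ≤ (x ^ 3 - E₂ * (1 - x ^ 2)) * (1 + x ^ 2) := mul_nonneg hE₂' (by positivity)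
    have t4 : 0 ≤ x * E₁ * (x ^ 3 - E₂ * (1 - x ^ 2)) := mul_nonneg (mul_nonneg hx0 hE₁) hE₂'
    have e : (1 - x ^ 2) * ((1 + x + E₁) * (1 - x - E₂) * (1 + x) -
        (1 - x - E₁) * (1 + x + E₂) * (1 - x)) =
        2 * (x * (1 - 3 * x ^ 2) + E₁ * (1 - 2 * x ^ 2) + (x ^ 3 - E₂ * (1 - x ^ 2)) * (1 + x ^ 2) +
          x * E₁ * (x ^ 3 - E₂ * (1 - x ^ 2))) := by
      ring
    have key : 0 ≤ (1 - x ^ 2) * ((1 + x + E₁) * (1 - x - E₂) * (1 + x) -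
        (1 - x - E₁) * (1 + x + E₂) * (1 - x)) := by
      rw [e]
      linarith
    exact (mul_nonneg_iff_of_pos_left h1x2).mp key
  -- general `u`
  have hMP : (1 - x) ^ u ≤ (1 + x) ^ u := pow_le_pow_left₀ (by linarith) (by linarith) u
  have hb0 : 0 ≤ (1 - x - E₁) * (1 + x + E₂) * (1 - x) :=
    mul_nonneg (mul_nonneg ha₁ (by linarith)) (by linarith)
  have hP : 0 ≤ (1 + x) ^ u := pow_nonneg (by linarith) u
  have h1 : (1 - x - E₁) * (1 + x + E₂) * (1 - x) * (1 - x) ^ u ≤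
      (1 - x - E₁) * (1 + x + E₂) * (1 - x) * (1 + x) ^ u := mul_le_mul_of_nonneg_left hMP hb0
  have h2 : (1 - x - E₁) * (1 + x + E₂) * (1 - x) * (1 + x) ^ u ≤
      (1 + x + E₁) * (1 - x - E₂) * (1 + x) * (1 + x) ^ u :=
    mul_le_mul_of_nonneg_right (sub_nonneg.mp hD) hP
  rw [pow_succ, pow_succ]
  nlinarith [h1, h2]

/-! ## The two cross products: signs from the boundary orders -/

/-- **Left cross product.** With `A_k = (1+x+E_k)(1+x)^{c-i_k}`, `A'_k = (1-2r_k)(1-x-E_k)(1-x)^{c-i_k}`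
(`E_k` the excursion sum of the left site `(i_k,r_k)`, `i_k ≤ c`): if `u₁ = (i₁,r₁)` precedes
`u₂ = (i₂,r₂)` in the left-end boundary order then `A₁A'₂ - A'₁A₂ ≥ 0` for `0 ≤ x ≤ 1/2`.
Different rows: a sum of two nonnegative products; same row: `(PM)^{min}` times an orientation
determinant (`ladderCB_orient`, the outer site first). [folklore] -/
private theorem ladderCB_signL {x E₁ E₂ : ℝ} (hx0 : 0 ≤ x) (hx : x ≤ 1 / 2) (hE₁ : 0 ≤ E₁)
    (hE₂ : 0 ≤ E₂) (hE₁b : E₁ * (1 - x ^ 2) ≤ x ^ 3) (hE₂b : E₂ * (1 - x ^ 2) ≤ x ^ 3)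
    {i₁ i₂ c : ℕ} (h₁ : i₁ ≤ c) (h₂ : i₂ ≤ c) {r₁ r₂ : ℤ}
    (hu : (r₁ = 1 ∧ r₂ = 0) ∨ (r₁ = 0 ∧ r₂ = 0 ∧ i₁ < i₂) ∨ (r₁ = 1 ∧ r₂ = 1 ∧ i₂ < i₁)) :
    0 ≤ (1 + x + E₁) * (1 + x) ^ (c - i₁) * ((1 - 2 * (r₂ : ℝ)) * (1 - x - E₂) * (1 - x) ^ (c - i₂)) -
      (1 - 2 * (r₁ : ℝ)) * (1 - x - E₁) * (1 - x) ^ (c - i₁) *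
        ((1 + x + E₂) * (1 + x) ^ (c - i₂)) := by
  have ha₁ : 0 ≤ 1 - x - E₁ := ladderCB_coef_nonneg hx0 hx hE₁ hE₁b
  have ha₂ : 0 ≤ 1 - x - E₂ := ladderCB_coef_nonneg hx0 hx hE₂ hE₂b
  have hM : 0 ≤ 1 - x := by linarith
  have hPM : ∀ m n : ℕ, 0 ≤ (1 + x) ^ m * (1 - x) ^ n := fun m n =>
    mul_nonneg (pow_nonneg (by linarith) m) (pow_nonneg hM n)
  rcases hu with ⟨rfl, rfl⟩ | ⟨rfl, rfl, hlt⟩ | ⟨rfl, rfl, hlt⟩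
  · -- `u₁` on the top row, `u₂` on the bottom row: both products are nonnegative
    push_cast
    nlinarith [mul_nonneg (mul_nonneg (by linarith : (0:ℝ) ≤ 1 + x + E₁) ha₂) (hPM (c - i₁) (c - i₂)),
      mul_nonneg (mul_nonneg ha₁ (by linarith : (0:ℝ) ≤ 1 + x + E₂)) (hPM (c - i₂) (c - i₁))]
  · -- both on the bottom row, `i₁ < i₂`: orientation determinant with `E₁` at the outer site `i₁`
    obtain ⟨d, hd⟩ : ∃ d, c - i₁ = c - i₂ + (d + 1) := ⟨i₂ - i₁ - 1, by omega⟩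
    rw [hd, pow_add (1 + x) (c - i₂) (d + 1), pow_add (1 - x) (c - i₂) (d + 1)]
    push_cast
    nlinarith [mul_nonneg (hPM (c - i₂) (c - i₂)) (ladderCB_orient hx0 hx hE₁ hE₂ hE₁b hE₂b d)]
  · -- both on the top row, `i₂ < i₁`: orientation determinant with `E₂` at the outer site `i₂`
    obtain ⟨d, hd⟩ : ∃ d, c - i₂ = c - i₁ + (d + 1) := ⟨i₁ - i₂ - 1, by omega⟩
    rw [hd, pow_add (1 + x) (c - i₁) (d + 1), pow_add (1 - x) (c - i₁) (d + 1)]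
    push_cast
    nlinarith [mul_nonneg (hPM (c - i₁) (c - i₁)) (ladderCB_orient hx0 hx hE₂ hE₁ hE₂b hE₁b d)]

/-- **Right cross product.** With `B_k = (1+x+E_k)(1+x)^{j_k-c-1}`, `B'_k = (1-2s_k)(1-x-E_k)(1-x)^{j_k-c-1}`
(`E_k` the excursion sum of the right site `(j_k,s_k)`, `c < j_k`): if `v₁ = (j₁,s₁)` precedes
`v₂ = (j₂,s₂)` in the right-end boundary order then `B₁B'₂ - B'₁B₂ ≤ 0` for `0 ≤ x ≤ 1/2`
(mirror image of `ladderCB_signL`). [folklore] -/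
private theorem ladderCB_signR {x E₃ E₄ : ℝ} (hx0 : 0 ≤ x) (hx : x ≤ 1 / 2) (hE₃ : 0 ≤ E₃)
    (hE₄ : 0 ≤ E₄) (hE₃b : E₃ * (1 - x ^ 2) ≤ x ^ 3) (hE₄b : E₄ * (1 - x ^ 2) ≤ x ^ 3)
    {j₁ j₂ c : ℕ} (h₁ : c < j₁) (h₂ : c < j₂) {s₁ s₂ : ℤ}
    (hv : (s₁ = 0 ∧ s₂ = 1) ∨ (s₁ = 0 ∧ s₂ = 0 ∧ j₁ < j₂) ∨ (s₁ = 1 ∧ s₂ = 1 ∧ j₂ < j₁)) :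
    (1 + x + E₃) * (1 + x) ^ (j₁ - c - 1) * ((1 - 2 * (s₂ : ℝ)) * (1 - x - E₄) * (1 - x) ^ (j₂ - c - 1)) -
        (1 - 2 * (s₁ : ℝ)) * (1 - x - E₃) * (1 - x) ^ (j₁ - c - 1) *
          ((1 + x + E₄) * (1 + x) ^ (j₂ - c - 1)) ≤ 0 := by
  have ha₃ : 0 ≤ 1 - x - E₃ := ladderCB_coef_nonneg hx0 hx hE₃ hE₃b
  have ha₄ : 0 ≤ 1 - x - E₄ := ladderCB_coef_nonneg hx0 hx hE₄ hE₄b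
  have hM : 0 ≤ 1 - x := by linarith
  have hPM : ∀ m n : ℕ, 0 ≤ (1 + x) ^ m * (1 - x) ^ n := fun m n =>
    mul_nonneg (pow_nonneg (by linarith) m) (pow_nonneg hM n)
  rcases hv with ⟨rfl, rfl⟩ | ⟨rfl, rfl, hlt⟩ | ⟨rfl, rfl, hlt⟩
  · -- `v₁` on the bottom row, `v₂` on the top row: both products are nonpositive
    push_cast
    nlinarith [mul_nonneg (mul_nonneg (by linarith : (0:ℝ) ≤ 1 + x + E₃) ha₄) (hPM (j₁ - c - 1) (j₂ - c - 1)),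
      mul_nonneg (mul_nonneg ha₃ (by linarith : (0:ℝ) ≤ 1 + x + E₄)) (hPM (j₂ - c - 1) (j₁ - c - 1))]
  · -- both on the bottom row, `j₁ < j₂`: orientation determinant with `E₄` at the outer site `j₂`
    obtain ⟨d, hd⟩ : ∃ d, j₂ - c - 1 = j₁ - c - 1 + (d + 1) := ⟨j₂ - j₁ - 1, by omega⟩
    rw [hd, pow_add (1 + x) (j₁ - c - 1) (d + 1), pow_add (1 - x) (j₁ - c - 1) (d + 1)]
    push_cast
    nlinarith [mul_nonneg (hPM (j₁ - c - 1) (j₁ - c - 1)) (ladderCB_orient hx0 hx hE₄ hE₃ hE₄b hE₃b d)]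
  · -- both on the top row, `j₂ < j₁`: orientation determinant with `E₃` at the outer site `j₁`
    obtain ⟨d, hd⟩ : ∃ d, j₁ - c - 1 = j₂ - c - 1 + (d + 1) := ⟨j₁ - j₂ - 1, by omega⟩
    rw [hd, pow_add (1 + x) (j₂ - c - 1) (d + 1), pow_add (1 - x) (j₂ - c - 1) (d + 1)]
    push_cast
    nlinarith [mul_nonneg (hPM (j₂ - c - 1) (j₂ - c - 1)) (ladderCB_orient hx0 hx hE₃ hE₄ hE₃b hE₄b d)]

/-! ## The rank-two form of the ladder kernels and the Cauchy–Binet step -/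

/-- **Nonnegativity of the rank-two form.** For `0 ≤ x ≤ 1/2`, admissible `E, E'` and rows `r, s ∈ {0,1}`
the real number `x/2 · x^p x^q · (A B + A' B')` is `≥ 0`: `|A' B'| = a' b' M^{p+q} ≤ a b P^{p+q} = A B`
termwise. [folklore] -/
private theorem ladderCB_form_nonneg {x E E' : ℝ} (hx0 : 0 ≤ x) (hx : x ≤ 1 / 2) (hE : 0 ≤ E)
    (hE' : 0 ≤ E') (hEb : E * (1 - x ^ 2) ≤ x ^ 3) (hE'b : E' * (1 - x ^ 2) ≤ x ^ 3) (p q : ℕ)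
    {r s : ℤ} (hr : r = 0 ∨ r = 1) (hs : s = 0 ∨ s = 1) :
    0 ≤ x / 2 * (x ^ p * x ^ q) *
      ((1 + x + E) * (1 + x) ^ p * ((1 + x + E') * (1 + x) ^ q) +
        (1 - 2 * (r : ℝ)) * (1 - x - E) * (1 - x) ^ p * ((1 - 2 * (s : ℝ)) * (1 - x - E') * (1 - x) ^ q)) := by
  have ha : 0 ≤ 1 - x - E := ladderCB_coef_nonneg hx0 hx hE hEb
  have ha' : 0 ≤ 1 - x - E' := ladderCB_coef_nonneg hx0 hx hE' hE'b
  have hM : 0 ≤ 1 - x := by linarith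
  have hPM : ∀ n : ℕ, (1 - x) ^ n ≤ (1 + x) ^ n := fun n => pow_le_pow_left₀ hM (by linarith) n
  have hT : 0 ≤ (1 - x - E) * (1 - x) ^ p * ((1 - x - E') * (1 - x) ^ q) :=
    mul_nonneg (mul_nonneg ha (pow_nonneg hM p)) (mul_nonneg ha' (pow_nonneg hM q))
  have hST : (1 - x - E) * (1 - x) ^ p * ((1 - x - E') * (1 - x) ^ q) ≤
      (1 + x + E) * (1 + x) ^ p * ((1 + x + E') * (1 + x) ^ q) :=
    mul_le_mul (mul_le_mul (by linarith) (hPM p) (pow_nonneg hM p) (by linarith))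
      (mul_le_mul (by linarith) (hPM q) (pow_nonneg hM q) (by linarith))
      (mul_nonneg ha' (pow_nonneg hM q)) (mul_nonneg (by linarith) (pow_nonneg (by linarith) p))
  have hστ : (1 - 2 * (r : ℝ)) * (1 - 2 * (s : ℝ)) = 1 ∨ (1 - 2 * (r : ℝ)) * (1 - 2 * (s : ℝ)) = -1 := by
    rcases hr with rfl | rfl <;> rcases hs with rfl | rfl <;> norm_num
  have key : (1 + x + E) * (1 + x) ^ p * ((1 + x + E') * (1 + x) ^ q) +
        (1 - 2 * (r : ℝ)) * (1 - x - E) * (1 - x) ^ p * ((1 - 2 * (s : ℝ)) * (1 - x - E') * (1 - x) ^ q) =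
      (1 + x + E) * (1 + x) ^ p * ((1 + x + E') * (1 + x) ^ q) +
        (1 - 2 * (r : ℝ)) * (1 - 2 * (s : ℝ)) * ((1 - x - E) * (1 - x) ^ p * ((1 - x - E') * (1 - x) ^ q)) := by
    ring
  rw [key]
  refine mul_nonneg (by positivity) ?_
  rcases hστ with h | h <;> rw [h] <;> linarith

/-- **Rank-two form of the ladder kernels.** For `i ≤ c < j ≤ L`, `r, s ∈ {0,1}` and `x ≥ 0`,
`Z_{R_L}((i,r),(j,s)) = x/2 · x^{c-i} x^{j-c-1} · (A B + A' B')` with `A = (1+x+E_i)(1+x)^{c-i}`,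
`A' = (1-2r)(1-x-E_i)(1-x)^{c-i}`, `B = (1+x+E_{L-j})(1+x)^{j-c-1}`, `B' = (1-2s)(1-x-E_{L-j})(1-x)^{j-c-1}`:
a regrouping of `stub_ladderKernels_interior` (`(if r = s then 1 else -1) = (1-2r)(1-2s)`). [folklore] -/
private theorem ladderCB_kernel (L i c j : ℕ) (hic : i ≤ c) (hcj : c < j) (hjL : j ≤ L) {x : ℝ}
    (hx : 0 ≤ x) (r s : ℤ) (hr : r = 0 ∨ r = 1) (hs : s = 0 ∨ s = 1) :
    pathKernel (discreteDomainGraph (rectDomain L 1) 1) x (st i r) (st j s) =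
      ENNReal.ofReal (x / 2 * (x ^ (c - i) * x ^ (j - c - 1)) *
        ((1 + x + ∑ d ∈ Finset.range i, x ^ (2 * d + 3)) * (1 + x) ^ (c - i) *
            ((1 + x + ∑ d ∈ Finset.range (L - j), x ^ (2 * d + 3)) * (1 + x) ^ (j - c - 1)) +
          (1 - 2 * (r : ℝ)) * (1 - x - ∑ d ∈ Finset.range i, x ^ (2 * d + 3)) * (1 - x) ^ (c - i) *
            ((1 - 2 * (s : ℝ)) * (1 - x - ∑ d ∈ Finset.range (L - j), x ^ (2 * d + 3)) *
              (1 - x) ^ (j - c - 1)))) := by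
  rw [stub_ladderKernels_interior L i j (by omega) hjL hx r s hr hs]
  congr 1
  have hε : (if r = s then (1 : ℝ) else -1) = (1 - 2 * (r : ℝ)) * (1 - 2 * (s : ℝ)) := by
    rcases hr with rfl | rfl <;> rcases hs with rfl | rfl <;> norm_num
  obtain ⟨p, rfl⟩ : ∃ p, c = i + p := ⟨c - i, by omega⟩
  obtain ⟨q, rfl⟩ : ∃ q, j = i + p + q + 1 := ⟨j - (i + p) - 1, by omega⟩
  have e1 : i + p + q + 1 - i = p + q + 1 := by omega
  have e2 : i + p - i = p := by omega
  have e3 : i + p + q + 1 - (i + p) - 1 = q := by omega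
  rw [hε, e1, e2, e3, Nat.add_sub_cancel]
  ring

/-- **Cauchy–Binet with inner dimension two.** For kernels of the form
`K_{kl} = x/2 · α_k β_l · (A_k B_l + A'_k B'_l)` one has
`K₁₂ K₂₁ - K₁₁ K₂₂ = (x/2)² α₁α₂β₁β₂ · (A₁A'₂ - A'₁A₂) · (-(B₁B'₂ - B'₁B₂))` (`ring`); hence a nonnegative
left cross product and a nonpositive right cross product give `K₁₁ K₂₂ ≤ K₁₂ K₂₁`. [folklore] -/
private theorem ladderCB_real {x α₁ α₂ β₁ β₂ A₁ A'₁ A₂ A'₂ B₁ B'₁ B₂ B'₂ : ℝ} (hα₁ : 0 ≤ α₁)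
    (hα₂ : 0 ≤ α₂) (hβ₁ : 0 ≤ β₁) (hβ₂ : 0 ≤ β₂) (hL : 0 ≤ A₁ * A'₂ - A'₁ * A₂)
    (hR : B₁ * B'₂ - B'₁ * B₂ ≤ 0) :
    x / 2 * (α₁ * β₁) * (A₁ * B₁ + A'₁ * B'₁) * (x / 2 * (α₂ * β₂) * (A₂ * B₂ + A'₂ * B'₂)) ≤
      x / 2 * (α₁ * β₂) * (A₁ * B₂ + A'₁ * B'₂) * (x / 2 * (α₂ * β₁) * (A₂ * B₁ + A'₂ * B'₁)) := by
  rw [← sub_nonneg]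
  have key : x / 2 * (α₁ * β₂) * (A₁ * B₂ + A'₁ * B'₂) * (x / 2 * (α₂ * β₁) * (A₂ * B₁ + A'₂ * B'₁)) -
      x / 2 * (α₁ * β₁) * (A₁ * B₁ + A'₁ * B'₁) * (x / 2 * (α₂ * β₂) * (A₂ * B₂ + A'₂ * B'₂)) =
      (x / 2) ^ 2 * (α₁ * α₂ * (β₁ * β₂)) * ((A₁ * A'₂ - A'₁ * A₂) * -(B₁ * B'₂ - B'₁ * B₂)) := by
    ring
  rw [key]
  exact mul_nonneg (mul_nonneg (by positivity) (mul_nonneg (mul_nonneg hα₁ hα₂) (mul_nonneg hβ₁ hβ₂)))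
    (mul_nonneg hL (by linarith))

/-! ## The stub -/

/-- **Tool stub `stub_ladder_minorCB`.** **Generic column-separated minor on the ladder.** On `{0..L}×{0,1}`
let `u₁ = (i₁,r₁)`, `u₂ = (i₂,r₂)` lie strictly left of `v₁ = (j₁,s₁)`, `v₂ = (j₂,s₂)` (`max i < min j`),
with `u₁` before `u₂` in the boundary order seen from the left end (top row leftwards, then bottom row
rightwards) and `v₁` before `v₂` in the order seen from the right end (bottom row rightwards, then top row
leftwards); then the crossing pairing weighs at most the nested one:
`Z(u₁,v₁)Z(u₂,v₂) ≤ Z(u₁,v₂)Z(u₂,v₁)` for `0 ≤ x ≤ 1/2`. Mechanism: in the rank-two form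
`Z((i,r),(j,s)) = x^{j-i}/2·⟨ℓ(i,r), r(j,s)⟩` the minor is `(x^{Σj-Σi}/4)(ℓ(u₁)×ℓ(u₂))(r(v₁)×r(v₂))`
(Cauchy–Binet) and the two cross products are signed by the two orders (`3x² ≤ 1`, `E_k ≤ x³/(1-x²)`).
[folklore] -/
theorem stub_ladder_minorCB (L : ℕ) {i₁ i₂ j₁ j₂ : ℕ} {r₁ r₂ s₁ s₂ : ℤ}
    (hr₁ : r₁ = 0 ∨ r₁ = 1) (hr₂ : r₂ = 0 ∨ r₂ = 1) (hs₁ : s₁ = 0 ∨ s₁ = 1) (hs₂ : s₂ = 0 ∨ s₂ = 1)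
    (hsep : max i₁ i₂ < min j₁ j₂) (hj₁ : j₁ ≤ L) (hj₂ : j₂ ≤ L)
    (hu : (r₁ = 1 ∧ r₂ = 0) ∨ (r₁ = 0 ∧ r₂ = 0 ∧ i₁ < i₂) ∨ (r₁ = 1 ∧ r₂ = 1 ∧ i₂ < i₁))
    (hv : (s₁ = 0 ∧ s₂ = 1) ∨ (s₁ = 0 ∧ s₂ = 0 ∧ j₁ < j₂) ∨ (s₁ = 1 ∧ s₂ = 1 ∧ j₂ < j₁))
    {x : ℝ} (hx0 : 0 ≤ x) (hx : x ≤ 1 / 2) :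
    pathKernel (discreteDomainGraph (rectDomain L 1) 1) x (st i₁ r₁) (st j₁ s₁) *
        pathKernel (discreteDomainGraph (rectDomain L 1) 1) x (st i₂ r₂) (st j₂ s₂) ≤
      pathKernel (discreteDomainGraph (rectDomain L 1) 1) x (st i₁ r₁) (st j₂ s₂) *
        pathKernel (discreteDomainGraph (rectDomain L 1) 1) x (st i₂ r₂) (st j₁ s₁) := by
  -- the pivot column `c = max i₁ i₂`: `i₁, i₂ ≤ c < j₁, j₂`
  obtain ⟨c, h₁, h₂, k₁, k₂⟩ : ∃ c, i₁ ≤ c ∧ i₂ ≤ c ∧ c < j₁ ∧ c < j₂ :=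
    ⟨max i₁ i₂, le_max_left _ _, le_max_right _ _, lt_of_lt_of_le hsep (min_le_left _ _),
      lt_of_lt_of_le hsep (min_le_right _ _)⟩
  have hE : ∀ k : ℕ, 0 ≤ ∑ d ∈ Finset.range k, x ^ (2 * d + 3) := ladderCB_excursion_nonneg hx0
  have hEb : ∀ k : ℕ, (∑ d ∈ Finset.range k, x ^ (2 * d + 3)) * (1 - x ^ 2) ≤ x ^ 3 :=
    ladderCB_excursion_bound hx0
  rw [ladderCB_kernel L i₁ c j₁ h₁ k₁ hj₁ hx0 r₁ s₁ hr₁ hs₁,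
    ladderCB_kernel L i₂ c j₂ h₂ k₂ hj₂ hx0 r₂ s₂ hr₂ hs₂,
    ladderCB_kernel L i₁ c j₂ h₁ k₂ hj₂ hx0 r₁ s₂ hr₁ hs₂,
    ladderCB_kernel L i₂ c j₁ h₂ k₁ hj₁ hx0 r₂ s₁ hr₂ hs₁,
    ← ENNReal.ofReal_mul
      (ladderCB_form_nonneg hx0 hx (hE i₁) (hE (L - j₁)) (hEb i₁) (hEb (L - j₁)) (c - i₁) (j₁ - c - 1)
        hr₁ hs₁),
    ← ENNReal.ofReal_mul
      (ladderCB_form_nonneg hx0 hx (hE i₁) (hE (L - j₂)) (hEb i₁) (hEb (L - j₂)) (c - i₁) (j₂ - c - 1)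
        hr₁ hs₂)]
  exact ENNReal.ofReal_le_ofReal
    (ladderCB_real (pow_nonneg hx0 _) (pow_nonneg hx0 _) (pow_nonneg hx0 _) (pow_nonneg hx0 _)
      (ladderCB_signL hx0 hx (hE i₁) (hE i₂) (hEb i₁) (hEb i₂) h₁ h₂ hu)
      (ladderCB_signR hx0 hx (hE (L - j₁)) (hE (L - j₂)) (hEb (L - j₁)) (hEb (L - j₂)) k₁ k₂ hv))

end Summit.CriticalPhenomena.SAWScalingLimit.Theorems.BoundaryTP2
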